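import Summits.BirchSwinnertonDyer.BirchSwinnertonDyer.Theorems.SignedBaseChangeAnticyclotomicEisensteinDivisibilityCurveModel
import Summits.BirchSwinnertonDyer.BirchSwinnertonDyer.Theorems.SignedBaseChangeAnticyclotomicEisensteinDivisibilityGreenbergFullAtSqueeze
import Summits.BirchSwinnertonDyer.BirchSwinnertonDyer.Theorems.SignedBaseChangeAnticyclotomicEisensteinDivisibilityFiniteExponentOfBridge
import HarnessLib

/-!
# Crux `AnticyclotomicEisensteinDivisibility` (stmt-BirchSwinnertonDyer-20727), line `bdpline` v15, stub
# `stub_finiteExponentSS`, Greenberg-2016 road: THE ASSEMBLY — Greenberg 2016 Prop. 4.1.1 (c) at the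
# twist deformation of `E_K[p^∞]` and the bridge hypothesis `hBr` of `stub_finiteExponentSS_of_bridge`,
# GRANTED the published facts, the line's torsion input, and the TWO remaining instance bricks
# (cofreeness of `E[p^∞]` with a Tate-dual basis; LOC_v⁽¹⁾ / `corank H⁰ = 0` at the places of `S`)
# (helper for stmt-BirchSwinnertonDyer-20727)

Cell `bsd-ssimc` (hosting route `SignedBaseChange`), width seat `bsd-line-sbc-p1-w2` gen 3; sixth file of
the lane (`…FiniteExponentOfBridge` p624977, `…GreenbergFullAtSqueeze` p625450, `…BridgeForCurve`
p625961, `…CurveModel` p626463, `…GroupLikeAeval`). This file CHECKS THAT THE PIECES FIT: for `K`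
imaginary quadratic, `p > 2` split as `v v̄`, a generator pair `(κ₁, κ₂; γ₁, γ₂)`, a Weierstrass curve
`W/K`, a finite `S ⊇ {w ∣ p}` on whose `p^∞`-torsion `N_S` acts trivially (`…CurveModel` §2: `S ⊇` bad
places), and the descended `ρ₀` on `A = PrimaryTorsion W.geomPoints p` (`…CurveModel` §3):

* `fullAtSelmer_isAlmostDivisible_curve` — **`S_{𝓛_v}(K, Ind_{K̃_∞/K} E_K[p^∞])` is almost divisible**,
  from: the PUBLISHED facts Greenberg 2016 Props. 4.1.1/4.2.2, Greenberg 2006 Props. 3.2/4.1/4.2/§5 A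
  (BY NAME); the line's input `Module.IsTorsion Λ₂ X_Gr₂` (= `stub_torsionSS`, which feeds
  `corank S_{𝓛_v} = 0` through the bridge and the end layer, whence LEO and CRK by the corank SQUEEZE at
  corank `m = rank_{ℤ_p} Hom(E[p^∞], ℚ/ℤ)` — no weak-Leopoldt input); and the two remaining INSTANCE
  BRICKS as displayed hypotheses: `hcofree : IsCofree ℤ_p E[p^∞]` with a `ℤ_p`-basis of a Tate dual
  `Hom(E[p^∞], K̄ˣ)` (`hTate`), and `hLOC1` / `h0loc` / `h0` (LOC_v⁽¹⁾ and `corank H⁰ = 0` at the finite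
  places of `S` and globally — the determinant form of Greenberg 2010 Lemma 5.2.2, whose algebra is
  `…GroupLikeAeval`). Everything else (cofreeness / RFX / corank / cofinite generation / `p`-primarity
  of `𝐃`, LOC⁽²⁾ everywhere, `e·f(v̄|p) = 1`, `r₂ = 1`, the places over `p`, LEO, CRK, clause (c)) is
  discharged here.
* `exists_almostDivisible_bridge_curve` — the consequence in the SHAPE OF `hBr`: an almost-divisible
  `Λ₂`-module balanced-isomorphic to `unrSelmer₂ κ₁ κ₂ E_K[p^∞] v̄`; hence
  `xGr₂_hasNoPseudoNullSubmodule_curve`: `X_Gr(E/K̃_∞)` has no non-zero pseudo-null `Λ₂`-submodule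
  (so `X_Gr₂[T₁] = 0` at `(T₁) ∉ Supp`, the stub with `m = 0`, by `S2.pow_smul_torsionBy_eq_zero_of_noPseudoNull`).

Theorems only; no definition, no named fact, no `sorry`. HONEST FRAMING: conditional on the displayed
hypotheses (six PUBLISHED named facts, the line's torsion input, two instance bricks); closes nothing by
itself (`--supports stmt-BirchSwinnertonDyer-20727`); no summit statement / BSD is proved by this file.
References: [Greenberg2016Selmer] Prop. 4.1.1 (c) p. 15, Prop. 4.2.2 p. 20, §4.3 pp. 20–21;
[Greenberg2006] Prop. 3.2 p. 358, Props. 4.1–4.2 pp. 367–368, §5 A p. 373, Thm. 3 p. 342;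
[Greenberg2010] Lemma 5.2.2; [BurungaleCastellaSkinner2025] §2.1 p. 6 (`X_Gr(E/K_∞)`).
-/

-- `Summit.BirchSwinnertonDyer.BirchSwinnertonDyer.…`: summit and sub-problem share a name (D-0017 layout).
set_option linter.dupNamespace false
set_option autoImplicit false

noncomputable section

open scoped Classical
open NumberField IsDedekindDomain Field
open Literature.NumberTheory.EllipticCurves Literature.NumberTheory.GaloisRepresentations
  Literature.NumberTheory.EllipticCurves.Rubin1991
  Literature.NumberTheory.IwasawaTheory Literature.NumberTheory.IwasawaTheory.Greenberg2006
  Literature.NumberTheory.IwasawaTheory.Greenberg2016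
  Summit.BirchSwinnertonDyer.BirchSwinnertonDyer.Theorems.GreenbergFullAtSelmer
  Summit.BirchSwinnertonDyer.BirchSwinnertonDyer.Theorems.TwistDeformationCofree
  Summit.BirchSwinnertonDyer.BirchSwinnertonDyer.Theorems.SignedBaseChangeAcDivFiniteExponent
  Summit.BirchSwinnertonDyer.BirchSwinnertonDyer.Theorems.SignedBaseChangeAcDivGreenbergSqueeze
  Summit.BirchSwinnertonDyer.BirchSwinnertonDyer.Theorems.SignedBaseChangeAcDivCurveModel

namespace Summit.BirchSwinnertonDyer.BirchSwinnertonDyer.Theorems.SignedBaseChangeAcDivAssembly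

variable {K : Type} [Field K] [NumberField K] {S : Set (HeightOneSpectrum (𝓞 K))} {p : ℕ}
  [Fact p.Prime] (W : WeierstrassCurve K)
  [TopologicalSpace (PowerSeries ℤ_[p])] [TopologicalSpace (PowerSeries (PowerSeries ℤ_[p]))]
  [IsTopologicalRing (PowerSeries (PowerSeries ℤ_[p]))]
  [IsTopologicalAddGroup (IndModule₂ ℤ_[p] p (PrimaryTorsion W.geomPoints p))]
  [ContinuousSMul (PowerSeries (PowerSeries ℤ_[p])) (IndModule₂ ℤ_[p] p (PrimaryTorsion W.geomPoints p))]
  (hS : ∀ v : HeightOneSpectrum (𝓞 K), ((p : ℕ) : 𝓞 K) ∈ v.asIdeal → v ∈ S)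
  (κ₁ κ₂ : ZpExtension K p)
  (ρ₀ : ContinuousRep (GaloisGroupUnramifiedOutside K S) ℤ_[p] (PrimaryTorsion W.geomPoints p))
  (vbar : HeightOneSpectrum (𝓞 K)) (γ₁ γ₂ : absoluteGaloisGroup K)
  [hγ : Fact (ZpExtension.IsTopGeneratorPair κ₁ κ₂ γ₁ γ₂)]

/-- **Greenberg 2016 Prop. 4.1.1 (c) at `𝐃 = Ind_{K̃_∞/K}(E_K[p^∞])`: `S_{𝓛_v}(K, 𝐃)` is almost divisible**,
granted the six PUBLISHED facts (by name), the line's `Λ₂`-torsion of `X_Gr₂`, and the two instance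
bricks `hcofree`/`hTate` and `hLOC1`/`h0loc`/`h0`; LEO and CRK by the corank squeeze at corank
`m = rank_{ℤ_p} Hom(E[p^∞], ℚ/ℤ)`, clause (c) at `η = v`.
[cite: Greenberg2016Selmer, Prop. 4.1.1 (c) (§4.1 p. 15 L21–32), §4.3 p. 20 L19–30]
[cite: Greenberg2006, Props. 3.2, 4.1, 4.2, §5 A; Thm. 3 p. 342] [cite: Greenberg2010, Lemma 5.2.2] -/
theorem fullAtSelmer_isAlmostDivisible_curve
    (h411 : prop411_selmer_isAlmostDivisible) (h422 : prop422_localCohomology_isAlmostDivisible)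
    (h5A : sec5A_localH2_subsingleton_of_LOC1) (h41 : prop41_globalEulerPoincareCorank)
    (h42 : prop42_localEulerPoincareCorank) (h32 : prop32_cohomology_isCofinitelyGenerated)
    (hSf : S.Finite) (hp : 2 < p) (hK : IsImaginaryQuadratic K)
    {v : HeightOneSpectrum (𝓞 K)} (hv : ((p : ℕ) : 𝓞 K) ∈ v.asIdeal)
    (hvbar : ((p : ℕ) : 𝓞 K) ∈ vbar.asIdeal) (hne : vbar ≠ v)
    (hNS : ∀ n ∈ ramificationSubgroup K S, ∀ P : PrimaryTorsion W.geomPoints p, n • P = P)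
    (hρ₀ : ∀ (σ : absoluteGaloisGroup K) (P : PrimaryTorsion W.geomPoints p),
      ρ₀ (toUnramifiedQuot K S σ) P = σ • P)
    -- the line's input: `X_Gr₂` is `Λ₂`-torsion (`stub_torsionSS`)
    (htors : Module.IsTorsion (IwasawaAlgebra₂ p) (W.XGr₂ p κ₁ κ₂ vbar γ₁ γ₂))
    -- instance brick 1: `E[p^∞]` is cofree over `ℤ_p`, with a basis of a Tate dual
    (hcofree : IsCofree ℤ_[p] (PrimaryTorsion W.geomPoints p))
    (hTate : ∃ (Y : Type) (_ : AddCommGroup Y) (_ : Module ℤ_[p] Y)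
      (tA : Y →+ (PrimaryTorsion W.geomPoints p →+ DiscreteGaloisModule.UnitsCarrier K))
      (_ : IsDualPairing ℤ_[p] (PrimaryTorsion W.geomPoints p) tA) (n : ℕ),
      Nonempty (Module.Basis (Fin n) ℤ_[p] Y))
    -- instance brick 2: LOC⁽¹⁾ and `corank H⁰ = 0` (determinant form of Greenberg 2010 Lemma 5.2.2)
    (hLOC1 : ∀ w : HeightOneSpectrum (𝓞 K), w ∈ S → LOC1 S (twistDeformation S hS κ₁ κ₂ ρ₀) (Sum.inr w))
    (h0loc : ∀ w : HeightOneSpectrum (𝓞 K), w ∈ S →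
      HasCorank (IwasawaAlgebra₂ p) ((localRep S (twistDeformation S hS κ₁ κ₂ ρ₀) (Sum.inr w)).H 0) 0)
    (h0 : HasCorank (IwasawaAlgebra₂ p) ((twistDeformation S hS κ₁ κ₂ ρ₀).H 0) 0) :
    IsAlmostDivisible (IwasawaAlgebra₂ p)
      (fullAtSpecification S (twistDeformation S hS κ₁ κ₂ ρ₀) (Sum.inr v)).selmer := by
  set ρ := twistDeformation S hS κ₁ κ₂ ρ₀ with hρ
  -- standing clauses of the arena at `Λ = R = Λ₂`
  have hΛ := nonempty_iwasawaAlgebraTwoVar_ringEquiv_mvPowerSeries p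
  have hcpl := isAdicComplete_maximalIdeal_iwasawaAlgebraTwoVar p
  have hres := finite_residueField_iwasawaAlgebraTwoVar p
  have hchar := charP_residueField_iwasawaAlgebraTwoVar p
  have hinj : Function.Injective
      (algebraMap (PowerSeries (PowerSeries ℤ_[p])) (PowerSeries (PowerSeries ℤ_[p]))) :=
    fun a b h ↦ by simpa using h
  have hfin : Module.Finite (PowerSeries (PowerSeries ℤ_[p])) (PowerSeries (PowerSeries ℤ_[p])) :=
    inferInstance
  have hlin : ∀ (g : GaloisGroupUnramifiedOutside K S) (r : PowerSeries (PowerSeries ℤ_[p]))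
      (d : IndModule₂ ℤ_[p] p (PrimaryTorsion W.geomPoints p)), ρ g (r • d) = r • ρ g d :=
    fun g r d ↦ twistDeformation_smul S hS κ₁ κ₂ ρ₀ g r d
  -- `𝐃`: cofree, cofinitely generated, `p`-primary, RFX, corank `m`
  have hA : ∀ a : PrimaryTorsion W.geomPoints p, ∃ k : ℕ, p ^ k • a = 0 := fun a ↦ by
    obtain ⟨k, hk⟩ := a.exists_pow_smul_eq_zero
    exact ⟨k, PrimaryTorsion.ext (by rw [PrimaryTorsion.val_nsmul]; exact hk)⟩
  have hT : IsCofree (PowerSeries (PowerSeries ℤ_[p])) (IndModule₂ ℤ_[p] p (PrimaryTorsion W.geomPoints p)) :=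
    IndModule₂.isCofree hA hcofree
  have hcf := IsCofree.isCofinitelyGenerated hT
  have hRFX : RFX (PowerSeries (PowerSeries ℤ_[p])) (IndModule₂ ℤ_[p] p (PrimaryTorsion W.geomPoints p)) :=
    IndModule₂.rfx hA hcofree
  have hm := IndModule₂.hasCorank (p := p) hA hcofree
  have hpD : ∀ d : IndModule₂ ℤ_[p] p (PrimaryTorsion W.geomPoints p), ∃ n : ℕ, (p ^ n : ℤ) • d = 0 :=
    IndModule₂.exists_pow_smul_eq_zero
  -- LOC⁽²⁾: at the finite places from LOC⁽¹⁾ and the free Tate duals; at the complex places trivially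
  haveI := hK.2
  have hKc : ∀ w : InfinitePlace K, w.IsComplex := IsTotallyComplex.isComplex
  obtain ⟨Y, _, _, tA, hY, n, ⟨b⟩⟩ := hTate
  have hLOC2 : ∀ w : Place K, InSigma S w → LOC2 S ρ w := by
    rintro (w | w) hw
    · exact loc2_inl_of_isComplex S ρ w (hKc w)
    · exact loc2_of_loc1_of_free (hLOC1 w ((inSigma_inr_iff S w).mp hw))
        fun Y' _ _ t' hY' ↦ IndModule₂.free_and_finite_of_isDualPairing hA b hY hY'
  -- `corank S_{𝓛_v} = 0` from the line's torsion input through the bridge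
  have hSel : HasCorank (IwasawaAlgebra₂ p) (fullAtSpecification S ρ (Sum.inr v)).selmer 0 := by
    obtain ⟨e, he⟩ := exists_addEquiv_unrSelmer₂_balanced_curve W hS κ₁ κ₂ ρ₀ vbar γ₁ γ₂ hp hK hv hvbar
      hne hNS hρ₀
    exact hasCorank_zero_of_xGr₂_isTorsion W p κ₁ κ₂ vbar γ₁ γ₂ htors e he
  -- LEO and CRK by the squeeze (η = v, η' = v̄ of local degree one; `r₂ = 1`)
  have hr₂ := nrComplexPlaces_eq_one_of_isImaginaryQuadratic hK
  have hdeg : vbar.asIdeal.ramificationIdx ℤ * vbar.asIdeal.inertiaDeg ℤ = 1 :=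
    (ncard_primesOver_eq_two_and_deg_one_of_ne hK.1 hv hvbar hne).2 hvbar
  have hSp : ∀ w : HeightOneSpectrum (𝓞 K), w ∈ S → ((p : ℕ) : 𝓞 K) ∈ w.asIdeal → w = v ∨ w = vbar :=
    fun w _ hw ↦ eq_or_eq_of_natCast_mem_of_ne hK.1 hv hvbar hne hw
  obtain ⟨hLEO, hCRK, -, -⟩ := leo_and_crk_fullAt_of_squeeze ρ h41 h42 h32 h5A hSf hS hKc hr₂ hΛ hpD hcf
    hm h0 (hS vbar hvbar) hne hvbar hdeg hSp hLOC1 h0loc hSel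
  -- Prop. 4.1.1 (c)
  exact fullAtSelmer_isAlmostDivisible_of_facts h411 h422 h5A hSf hS hΛ hinj hfin hcpl hres hchar
    hlin hT hcf hpD hRFX hLEO hLOC2 (hS v hv) (hLOC1 v (hS v hv)) hCRK

/-- **The bridge hypothesis `hBr` of `stub_finiteExponentSS_of_bridge`, at the instance**: under the
hypotheses of `fullAtSelmer_isAlmostDivisible_curve`, some almost-divisible `Λ₂`-module is balanced-
isomorphic to `unrSelmer₂ κ₁ κ₂ E_K[p^∞] v̄` (namely `S_{𝓛_v}(K, Ind E_K[p^∞])`, through the Shapiro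
bridge of `…CurveModel`). [cite: Greenberg2016Selmer, Prop. 4.1.1 p. 15] [cite: Greenberg2006, Thm. 3 p. 342] -/
theorem exists_almostDivisible_bridge_curve
    (h411 : prop411_selmer_isAlmostDivisible) (h422 : prop422_localCohomology_isAlmostDivisible)
    (h5A : sec5A_localH2_subsingleton_of_LOC1) (h41 : prop41_globalEulerPoincareCorank)
    (h42 : prop42_localEulerPoincareCorank) (h32 : prop32_cohomology_isCofinitelyGenerated)
    (hSf : S.Finite) (hp : 2 < p) (hK : IsImaginaryQuadratic K)
    {v : HeightOneSpectrum (𝓞 K)} (hv : ((p : ℕ) : 𝓞 K) ∈ v.asIdeal)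
    (hvbar : ((p : ℕ) : 𝓞 K) ∈ vbar.asIdeal) (hne : vbar ≠ v)
    (hNS : ∀ n ∈ ramificationSubgroup K S, ∀ P : PrimaryTorsion W.geomPoints p, n • P = P)
    (hρ₀ : ∀ (σ : absoluteGaloisGroup K) (P : PrimaryTorsion W.geomPoints p),
      ρ₀ (toUnramifiedQuot K S σ) P = σ • P)
    (htors : Module.IsTorsion (IwasawaAlgebra₂ p) (W.XGr₂ p κ₁ κ₂ vbar γ₁ γ₂))
    (hcofree : IsCofree ℤ_[p] (PrimaryTorsion W.geomPoints p))
    (hTate : ∃ (Y : Type) (_ : AddCommGroup Y) (_ : Module ℤ_[p] Y)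
      (tA : Y →+ (PrimaryTorsion W.geomPoints p →+ DiscreteGaloisModule.UnitsCarrier K))
      (_ : IsDualPairing ℤ_[p] (PrimaryTorsion W.geomPoints p) tA) (n : ℕ),
      Nonempty (Module.Basis (Fin n) ℤ_[p] Y))
    (hLOC1 : ∀ w : HeightOneSpectrum (𝓞 K), w ∈ S → LOC1 S (twistDeformation S hS κ₁ κ₂ ρ₀) (Sum.inr w))
    (h0loc : ∀ w : HeightOneSpectrum (𝓞 K), w ∈ S →
      HasCorank (IwasawaAlgebra₂ p) ((localRep S (twistDeformation S hS κ₁ κ₂ ρ₀) (Sum.inr w)).H 0) 0)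
    (h0 : HasCorank (IwasawaAlgebra₂ p) ((twistDeformation S hS κ₁ κ₂ ρ₀).H 0) 0) :
    ∃ (Sgr : Type) (_ : AddCommGroup Sgr) (_ : Module (IwasawaAlgebra₂ p) Sgr)
      (e : Sgr ≃+ unrSelmer₂ κ₁ κ₂ (W.geomPrimaryTorsion p) vbar),
      IsAlmostDivisible (IwasawaAlgebra₂ p) Sgr ∧
        ∀ (r : IwasawaAlgebra₂ p) (x : W.XGr₂ p κ₁ κ₂ vbar γ₁ γ₂) (c : Sgr), (r • x) (e c) = x (e (r • c)) := by
  obtain ⟨e, he⟩ := exists_addEquiv_unrSelmer₂_balanced_curve W hS κ₁ κ₂ ρ₀ vbar γ₁ γ₂ hp hK hv hvbar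
    hne hNS hρ₀
  exact ⟨_, inferInstance, inferInstance, e,
    fullAtSelmer_isAlmostDivisible_curve W hS κ₁ κ₂ ρ₀ vbar γ₁ γ₂ h411 h422 h5A h41 h42 h32 hSf hp hK
      hv hvbar hne hNS hρ₀ htors hcofree hTate hLOC1 h0loc h0, he⟩

/-- **`X_Gr(E/K̃_∞)` has no non-zero pseudo-null `Λ₂`-submodule**, under the hypotheses of
`fullAtSelmer_isAlmostDivisible_curve` (end layer `xGr₂_hasNoPseudoNullSubmodule_of_isAlmostDivisible`).
[cite: Greenberg2016Selmer, §1 p. 2, Prop. 4.1.1 p. 15] [cite: BurungaleCastellaSkinner2025, §2.1 p. 6] -/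
theorem xGr₂_hasNoPseudoNullSubmodule_curve
    (h411 : prop411_selmer_isAlmostDivisible) (h422 : prop422_localCohomology_isAlmostDivisible)
    (h5A : sec5A_localH2_subsingleton_of_LOC1) (h41 : prop41_globalEulerPoincareCorank)
    (h42 : prop42_localEulerPoincareCorank) (h32 : prop32_cohomology_isCofinitelyGenerated)
    (hSf : S.Finite) (hp : 2 < p) (hK : IsImaginaryQuadratic K)
    {v : HeightOneSpectrum (𝓞 K)} (hv : ((p : ℕ) : 𝓞 K) ∈ v.asIdeal)
    (hvbar : ((p : ℕ) : 𝓞 K) ∈ vbar.asIdeal) (hne : vbar ≠ v)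
    (hNS : ∀ n ∈ ramificationSubgroup K S, ∀ P : PrimaryTorsion W.geomPoints p, n • P = P)
    (hρ₀ : ∀ (σ : absoluteGaloisGroup K) (P : PrimaryTorsion W.geomPoints p),
      ρ₀ (toUnramifiedQuot K S σ) P = σ • P)
    (htors : Module.IsTorsion (IwasawaAlgebra₂ p) (W.XGr₂ p κ₁ κ₂ vbar γ₁ γ₂))
    (hcofree : IsCofree ℤ_[p] (PrimaryTorsion W.geomPoints p))
    (hTate : ∃ (Y : Type) (_ : AddCommGroup Y) (_ : Module ℤ_[p] Y)
      (tA : Y →+ (PrimaryTorsion W.geomPoints p →+ DiscreteGaloisModule.UnitsCarrier K))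
      (_ : IsDualPairing ℤ_[p] (PrimaryTorsion W.geomPoints p) tA) (n : ℕ),
      Nonempty (Module.Basis (Fin n) ℤ_[p] Y))
    (hLOC1 : ∀ w : HeightOneSpectrum (𝓞 K), w ∈ S → LOC1 S (twistDeformation S hS κ₁ κ₂ ρ₀) (Sum.inr w))
    (h0loc : ∀ w : HeightOneSpectrum (𝓞 K), w ∈ S →
      HasCorank (IwasawaAlgebra₂ p) ((localRep S (twistDeformation S hS κ₁ κ₂ ρ₀) (Sum.inr w)).H 0) 0)
    (h0 : HasCorank (IwasawaAlgebra₂ p) ((twistDeformation S hS κ₁ κ₂ ρ₀).H 0) 0) :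
    HasNoPseudoNullSubmodule (IwasawaAlgebra₂ p) (W.XGr₂ p κ₁ κ₂ vbar γ₁ γ₂) := by
  obtain ⟨Sgr, _, _, e, hAD, he⟩ := exists_almostDivisible_bridge_curve W hS κ₁ κ₂ ρ₀ vbar γ₁ γ₂ h411 h422
    h5A h41 h42 h32 hSf hp hK hv hvbar hne hNS hρ₀ htors hcofree hTate hLOC1 h0loc h0
  exact xGr₂_hasNoPseudoNullSubmodule_of_isAlmostDivisible W p κ₁ κ₂ vbar γ₁ γ₂ hAD e he

end Summit.BirchSwinnertonDyer.BirchSwinnertonDyer.Theorems.SignedBaseChangeAcDivAssembly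

end
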